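import Literature.AlgebraicGeometry.HodgeTheory.AtiyahClassTraceReal
import Literature.AlgebraicGeometry.Modules.Biduality
import Literature.AlgebraicGeometry.Modules.VectorBundleFiniteLocallyFree
import Literature.AlgebraicGeometry.Modules.LinearOverBase
import Mathlib.Algebra.Homology.DerivedCategory.Ext.Linear
import Summits.HodgeConjecture.HodgeConjecture.Cruxes.BlochSeedDiscOne.Anchor
import HarnessLib

/-!
# `StaticAlongTW` — layer (A): the SHEAF-LEVEL law «first-order unobstructed along the `ψ₀`-Weil tangent family»
# (director-hodge R19.867 (L2′); hsemireg-semihom-1 g68; crux item `stmt-HodgeConjecture-18881`, decl `BlochSeedDiscOne`)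

Token: `line stmt-HodgeConjecture-18881 Cruxes/BlochSeedDiscOne/Lines/birth.lean 814a6a70c14e831a stub_rung_pad4_seedAt` — the stub is
UNTOUCHED; this file imports neither `Lines/birth.lean` nor any `Lines/*`; it proves NOTHING toward HC ∕ HC_CM ∕ HC_AV ∕ №4 ∕ 26512 ∕ 18881 ∕
30548 ∕ H2.  Census-neutral: definitions + unfolding lemmas only; no `sorry`, no `axiom`, no `instance`, no `notation`.

## What is typed here (R19.867 (ii): "prefer DEFINITIONS if they type in one session; else the honest INTERFACE")

* **D-L2b DEFINED** (§1, for any `S`-scheme `X : Over (Spec S)` and any finite locally free `E`):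
  - `DefT1 X := Ext¹_{𝒪_X}(Ω¹_{X/S}, 𝒪_X)` — the first-order deformation space `T¹(X/S)` in the Lichtenbaum–Schlessinger ∕ Huybrechts–Thomas
    form: a first-order deformation class is a morphism `κ : Ω¹_{X/S} → 𝒪_X[1]` (for `X/S` smooth this is `H¹(X, 𝒯_{X/S})` by
    `Ext¹(Ω¹, 𝒪) ≅ H¹(𝓗om(Ω¹, 𝒪))`, Hartshorne III.6.3 (c) ∕ 6.7; the truncated Kodaira–Spencer class `κ(X₀/X) ∈ Ext¹(L_{X₀}, I)` of
    [HuybrechtsThomas2010, main Theorem] with `I = 𝒪`);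
  - `obstructionMap hE : DefT1 X →+ Ext²(E, E)`, `κ ↦ (id_E ⊗ κ) ∘ At(E)` — the tree's REAL Atiyah class
    `HodgeTheory.atiyahClass E : Ext¹(E, 𝓗om(E^∨, Ω¹))` (`AtiyahClass.lean`) Yoneda-composed with `𝓗om(E^∨, κ) : 𝓗om(E^∨, Ω¹) → 𝓗om(E^∨, 𝒪)[1]`
    (the EXACT functor `𝓗om(E^∨, –)`, `Modules.preservesFiniteColimits_sheafHomFunctor`, Mathlib `Functor.mapExtAddHom`) and then with the
    inverse of biduality `E^∨∨ ≅ E` (`Modules.isIso_toBidual`).  This is LITERALLY the obstruction class of [HuybrechtsThomas2010, Theorem p. 3 and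
    Cor. 3.4]: «there is a deformation `E` of `E₀` over the square-zero thickening iff `0 = (id_{E₀} ⊗ κ(X₀/X)) ∘ A(E₀) ∈ Ext²(E₀, E₀ ⊗ I)`»
    [corpus: paper:arxiv-0805.3527 p.3, p.10], with `E ⊗ –` modelled as `𝓗om(E^∨, –)` exactly as in `AtiyahClassTraceReal.traceExtCoeff`.
  - `UnobstructedAlong hE T : Prop := ∀ κ ∈ T, obstructionMap hE κ = 0` for a set `T` of deformation classes.
* **D-L2a NOT definable today ⇒ honest INTERFACE** (§2): `WeilTangentFamily E₀ ψ₀` — a `ℂ`-submodule `carrier ≤ T¹(S⁴/ℂ)` of the pad-4 anchor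
  `S⁴ = (pad4Anchor E₀).X` of the Weil-family dimension `4² = 16`, PASSED AS A PARAMETER.  Its INTENDED instance — the Kodaira–Spencer image of
  the unitary `(4,4)` Weil family through `(S⁴, λ, ψ = pad4Action E₀ ψ₀)`, i.e. the polarised, `ψ`-compatible first-order deformations — needs the
  action of `ψ` on `T¹` and the polarisation class, neither typed in the tree: recorded as DEFINITION REQUEST D-L2a (memo `STATIC-ALONG-TW-semihom1-g68.md`
  §3), a SEPARATE construction statement; nothing here asserts that an instance exists and no `∀ W`/`∃ W` hides inside the law.
* **THE LAW** (§2): `StaticAlongTWSheaf W 𝓔 h𝓔 : Prop := UnobstructedAlong h𝓔 W.carrier` — «∀ κ ∈ T_W(E₀, ψ₀), κ ⌟ At(𝓔) = 0 ∈ Ext²(𝓔, 𝓔)» for a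
  vector bundle `𝓔` on `S⁴` (intended: the cokernel `δ₀.S.X₃` of a split block, `δ₀.isVectorBundle₃`).  Layer (B) `StaticAlongTWDatumLaw.lean` turns it
  into `StaticAlongTW W : SplitBlock.DatumLaw := fun E₀ ψ₀ δ₀ => StaticAlongTWSheaf (W E₀ ψ₀) δ₀.S.X₃ δ₀.isVectorBundle₃` over v42.1.
  It is NOT `RuleD δ₀.Dsh.shadow` or any row (R19.867 (i), costume rule): the bridge «static along `T_W` ⟹ RULE D of the shadow» is a THEOREM-SHAPED
  STUB for cruxplan-18881-splitblock's skeleton (`stub_alpha1_of_static`, memo §4), to be PROVED, pen source g65 §6 P2 + §1 D3, hsem-3 memo-211.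

HONESTY (R19.867 (v)): the law is a HYPOTHESIS on a datum; `obstructionMap` is a definition, not a theorem about any sheaf; `WeilTangentFamily` is an
interface whose intended instance is OPEN (D-L2a); typed ≠ proved.  General §1 is Literature-grade (promotable to
`Literature/AlgebraicGeometry/Deformation/ObstructionAlongBaseDeformation.lean`); it sits here only because this seat writes through `crux write`.
-/

noncomputable section

set_option linter.dupNamespace false
set_option autoImplicit false

open CategoryTheory CategoryTheory.Abelian CategoryTheory.Limits AlgebraicGeometry
open Literature.AlgebraicGeometry Literature.AlgebraicGeometry.Modules Literature.AlgebraicGeometry.Motives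
open Literature.AlgebraicGeometry.HodgeTheory

namespace Summit.HodgeConjecture.HodgeConjecture.Cruxes.BlochSeedDiscOne.StaticAlongTW

universe w u

/-! ## §1 D-L2b: `T¹(X/S)` and the obstruction map `κ ↦ (id_E ⊗ κ) ∘ At(E)` (general `S`-scheme, `E` finite locally free) -/

section General

variable {S : Type u} [CommRing S] (X : Over (Spec (CommRingCat.of S))) [HasExt.{w} X.left.Modules]

/-- **`T¹(X/S) := Ext¹_{𝒪_X}(Ω¹_{X/S}, 𝒪_X)`** — first-order deformation classes of `X/S` as morphisms `κ : Ω¹_{X/S} → 𝒪_X[1]` (the truncated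
Kodaira–Spencer class of a first-order thickening with ideal `I ≅ 𝒪_X`; `= H¹(X, 𝒯_{X/S})` for `X/S` smooth).
[cite: HuybrechtsThomas2010, Introduction (κ(X₀/X) ∈ Ext¹(L_{X₀}, I)) and Def. 2.5] [cite: Hartshorne1977, III.6.3 (c), III.6.7] -/
abbrev DefT1 : Type w := Ext.{w} (cotangentSheaf X) (unitModule X.left) 1

variable {X} {E : X.left.Modules} (hE : IsFiniteLocallyFree E)

/-- **`κ ↦ id_E ⊗ κ`**: the exact functor `𝓗om(E^∨, –)` (`≅ E ⊗ –` for `E` finite locally free) applied to a deformation class,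
`𝓗om(E^∨, κ) : 𝓗om(E^∨, Ω¹) → 𝓗om(E^∨, 𝒪_X)[1] = E^∨∨[1]` (Mathlib `Functor.mapExtAddHom`; exactness `Modules.preservesFiniteColimits_sheafHomFunctor`
for the finite locally free `E^∨`, `Modules.isFiniteLocallyFree_dual`). [cite: HuybrechtsThomas2010, Cor. 3.4 (id_{E₀} ⊗ κ)] [cite: Hartshorne1977, II Ex. 5.1 (b)] -/
def twistDefClass : DefT1 X →+ Ext.{w} (twistCotangent E) (sheafHom (dual E) (unitModule X.left)) 1 :=
  haveI := preservesFiniteColimits_sheafHomFunctor (dual E) (isFiniteLocallyFree_dual hE)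
  (sheafHomFunctor (dual E)).mapExtAddHom (cotangentSheaf X) (unitModule X.left) 1

/-- **The obstruction map before biduality**: `ob^{∨∨}_E : T¹(X/S) → Ext²(E, E^∨∨)`, `κ ↦ At(E) · (id_E ⊗ κ)` — Yoneda composite
`E → 𝓗om(E^∨, Ω¹)[1] → 𝓗om(E^∨, 𝒪_X)[2]` of the tree's Atiyah class `HodgeTheory.atiyahClass E` with `twistDefClass hE κ`.
[cite: HuybrechtsThomas2010, main Theorem and Cor. 3.4] -/
def obstructionBidual : DefT1 X →+ Ext.{w} E (sheafHom (dual E) (unitModule X.left)) 2 :=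
  ((atiyahClass E).precomp (sheafHom (dual E) (unitModule X.left)) (rfl : 1 + 1 = 2)).comp (twistDefClass hE)

/-- **D-L2b — the obstruction map `ob_E : T¹(X/S) → Ext²_{𝒪_X}(E, E)`, `κ ↦ (id_E ⊗ κ) ∘ At(E)`** («`κ ⌟ At(E)`»): `obstructionBidual` followed by the
inverse of the biduality isomorphism `E → E^∨∨` (`Modules.isIso_toBidual hE`, Hartshorne II Ex. 5.1 (a)).  By [HuybrechtsThomas2010, Theorem ∕ Cor. 3.4]
`ob_E(κ) = 0` iff `E` extends to the first-order deformation of `X` with class `κ`.  An additive map; `ℂ`-linearity is not needed below and not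
recorded. [cite: HuybrechtsThomas2010, main Theorem and Cor. 3.4] [cite: Hartshorne1977, II Ex. 5.1 (a)] -/
def obstructionMap : DefT1 X →+ Ext.{w} E E 2 :=
  haveI := isIso_toBidual E hE
  ((Ext.mk₀ (inv (toBidual E (unitModule X.left)))).postcomp E (add_zero 2)).comp (obstructionBidual hE)

/-- Unfolding `obstructionBidual`: `ob^{∨∨}_E(κ) = At(E) · (id_E ⊗ κ)`. -/
lemma obstructionBidual_apply (κ : DefT1 X) :
    obstructionBidual hE κ = (atiyahClass E).comp (twistDefClass hE κ) (rfl : 1 + 1 = 2) := rfl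

/-- Unfolding `obstructionMap`: `ob_E(κ) = (At(E) · (id_E ⊗ κ)) · (E^∨∨ ≅ E)`. -/
lemma obstructionMap_apply (κ : DefT1 X) :
    obstructionMap hE κ =
      haveI := isIso_toBidual E hE
      (obstructionBidual hE κ).comp (Ext.mk₀ (inv (toBidual E (unitModule X.left)))) (add_zero 2) := rfl

/-- `ob_E(0) = 0` (sanity: the trivial deformation is unobstructed). -/
lemma obstructionMap_zero : obstructionMap hE 0 = 0 := map_zero _

/-- **First-order unobstructed along a family of deformation classes**: `∀ κ ∈ T, ob_E(κ) = 0` — `E` extends to first order along every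
direction of `T` [HuybrechtsThomas2010, Cor. 3.4].  A `Prop` about `(E, T)`; a HYPOTHESIS wherever used. -/
def UnobstructedAlong (T : Set (DefT1 X)) : Prop :=
  ∀ κ ∈ T, obstructionMap hE κ = 0

lemma unobstructedAlong_iff (T : Set (DefT1 X)) : UnobstructedAlong hE T ↔ ∀ κ ∈ T, obstructionMap hE κ = 0 := Iff.rfl

/-- monotone in the family: unobstructed along `T'` ⟹ unobstructed along any `T ⊆ T'`. -/
lemma UnobstructedAlong.mono {T T' : Set (DefT1 X)} (hTT' : T ⊆ T') (h : UnobstructedAlong hE T') : UnobstructedAlong hE T :=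
  fun κ hκ => h κ (hTT' hκ)

/-- the empty family imposes nothing (recorded so that NO use of the law may take `T = ∅`: see `WeilTangentFamily.finrank_carrier`). -/
lemma unobstructedAlong_empty : UnobstructedAlong hE (∅ : Set (DefT1 X)) := fun _ h => absurd h (Set.notMem_empty _)

/-- a sheaf with `Ext²(E, E) = 0` (more generally: subsingleton) is unobstructed along every family — the classical «`H²`-unobstructed» case. -/
lemma unobstructedAlong_of_subsingleton [Subsingleton (Ext.{w} E E 2)] (T : Set (DefT1 X)) : UnobstructedAlong hE T :=
  fun _ _ => Subsingleton.elim _ _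

/-- equivalently: `T` lies in the kernel of `ob_E`. -/
lemma unobstructedAlong_iff_subset_ker (T : Set (DefT1 X)) :
    UnobstructedAlong hE T ↔ T ⊆ (obstructionMap hE).ker := by
  refine ⟨fun h κ hκ => ?_, fun h κ hκ => ?_⟩
  · exact (AddMonoidHom.mem_ker).2 (h κ hκ)
  · exact (AddMonoidHom.mem_ker).1 (h hκ)

end General

/-! ## §2 The pad-4 anchor: the interface `WeilTangentFamily` (D-L2a pending) and the sheaf-level law `StaticAlongTWSheaf` -/

section Anchor

open Summit.HodgeConjecture.HodgeConjecture.Cruxes.BlochSeedDiscOne.Anchor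

/-- `T¹(S⁴/ℂ)` of the pad-4 anchor `S⁴ = (pad4Anchor E₀).X` (`= H¹(S⁴, 𝒯)`, of dimension `8² = 64` when `dim E₀ = 1`); a `ℂ`-module through
`Modules.instLinearOverBase` + Mathlib `Ext.Linear`. -/
abbrev AnchorT1 (E₀ : AbelianVariety ℂ) : Type 1 := DefT1 (pad4Anchor E₀).X

/-- the Weil-family dimension `n² = 16`, `n = 4 = dim S⁴ / 2`: the unitary `(n,n)` Weil family of polarised abelian `2n`-folds with
`ℚ(i)`-action of signature `(n,n)` has dimension `n²`. [cite: vanGeemen1994, §5 (abelian varieties of Weil type, n²-dimensional families)] -/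
def weilFamilyDim : ℕ := 4 ^ 2

lemma weilFamilyDim_eq : weilFamilyDim = 16 := by decide

/-- **INTERFACE for D-L2a — the `ψ₀`-Weil tangent family `T_W(E₀, ψ₀) ≤ T¹(S⁴/ℂ)`**, PASSED AS A PARAMETER (R19.867 (ii)).  Fields: the
`ℂ`-submodule `carrier` and its dimension `16` (which in particular forbids the vacuous instance `⊥`).  INTENDED INSTANCE (not constructed — needs
the action of `ψ = pad4Action E₀ ψ₀` on `T¹` and the polarisation class, DEFINITION REQUEST D-L2a): the Kodaira–Spencer image at `(S⁴, λ, ψ)` of the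
unitary `(4,4)` Weil family = the polarised, `ψ`-compatible first-order deformations `{κ : κ ⌟ λ = 0, ψ_* κ = κ}` (`≅ V_i ⊗ V_{-i} ≅ M₄(ℂ)`).
Any theorem quantifying over `W : WeilTangentFamily E₀ ψ₀` must carry the properties of `T_W` it uses as explicit hypotheses until D-L2a lands. -/
structure WeilTangentFamily (E₀ : AbelianVariety ℂ) (ψ₀ : E₀ ⟶ E₀) : Type 1 where
  /-- `T_W(E₀, ψ₀)` as a `ℂ`-submodule of `T¹(S⁴/ℂ)` -/
  carrier : Submodule ℂ (AnchorT1 E₀)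
  /-- `dim_ℂ T_W = 4² = 16` -/
  finrank_carrier : Module.finrank ℂ carrier = weilFamilyDim

variable {E₀ : AbelianVariety ℂ} {ψ₀ : E₀ ⟶ E₀}

/-- **THE LAW (sheaf level) — `StaticAlongTWSheaf W 𝓔 h𝓔`: «`𝓔` is first-order unobstructed along the `ψ₀`-Weil tangent family:
∀ κ ∈ T_W(E₀, ψ₀), κ ⌟ At(𝓔) = 0 ∈ Ext²(𝓔, 𝓔)`»** for a vector bundle `𝓔` on `S⁴` (intended: `𝓔 := δ₀.S.X₃`, `h𝓔 := δ₀.isVectorBundle₃` of a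
C-free split block `δ₀`).  A HYPOTHESIS on the datum (R19.867 (i)); by [HuybrechtsThomas2010, Cor. 3.4] it says `𝓔` extends to first order over
every direction of the Weil family.  NOT a row of the shadow; the bridge to RULE D is the stub `stub_alpha1_of_static` (layer (B), memo §4). -/
def StaticAlongTWSheaf (W : WeilTangentFamily E₀ ψ₀) (𝓔 : (pad4Anchor E₀).X.left.Modules) (h𝓔 : IsVectorBundle 𝓔) : Prop :=
  UnobstructedAlong (isFiniteLocallyFree_of_isVectorBundle h𝓔) (W.carrier : Set (AnchorT1 E₀))

variable (W : WeilTangentFamily E₀ ψ₀) (𝓔 : (pad4Anchor E₀).X.left.Modules) (h𝓔 : IsVectorBundle 𝓔)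

lemma staticAlongTWSheaf_iff :
    StaticAlongTWSheaf W 𝓔 h𝓔 ↔ ∀ κ ∈ W.carrier, obstructionMap (isFiniteLocallyFree_of_isVectorBundle h𝓔) κ = 0 := Iff.rfl

/-- the law in kernel form: `T_W ≤ ker ob_𝓔`. -/
lemma staticAlongTWSheaf_iff_le_ker :
    StaticAlongTWSheaf W 𝓔 h𝓔 ↔ W.carrier.toAddSubgroup ≤ (obstructionMap (isFiniteLocallyFree_of_isVectorBundle h𝓔)).ker := by
  rw [StaticAlongTWSheaf, unobstructedAlong_iff_subset_ker]
  exact Iff.rfl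

/-- an `Ext²`-unobstructed bundle (`Ext²(𝓔, 𝓔)` subsingleton) satisfies the law — e.g. this is how the law is DISCHARGED wherever `Ext²(𝓔,𝓔) = 0`. -/
lemma staticAlongTWSheaf_of_subsingleton [Subsingleton (Ext 𝓔 𝓔 2)] : StaticAlongTWSheaf W 𝓔 h𝓔 :=
  unobstructedAlong_of_subsingleton _ _

/-- `T_W ≠ ⊥`: the interface excludes the vacuous family (its dimension is `16`). -/
lemma WeilTangentFamily.carrier_ne_bot : W.carrier ≠ ⊥ := by
  intro h
  have h16 := W.finrank_carrier
  rw [h, weilFamilyDim] at h16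
  simp at h16

/-- **«`T_W` preserves the line bundle `L` to first order»** is the SAME law applied to `L`: `StaticAlongTWSheaf W L hL` (`ob_L(κ) = κ ⌟ At(L)`,
`tr At(L) = c₁(L)` up to the sign convention of `AtiyahClass.lean`).  For the polarisation `L = 𝒪(λ)` of `S⁴` this is one of the two defining
properties of the intended instance of D-L2a (the other, `ψ`-compatibility, is not typable today). -/
abbrev PreservesToFirstOrder (L : (pad4Anchor E₀).X.left.Modules) (hL : IsVectorBundle L) : Prop := StaticAlongTWSheaf W L hL

end Anchor

end Summit.HodgeConjecture.HodgeConjecture.Cruxes.BlochSeedDiscOne.StaticAlongTW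

end
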